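import Mathlib
import Literature.MathematicalPhysics.QuantumLattice.AngularSectors
import Literature.MathematicalPhysics.QuantumLattice.HubbardFermiCurve
import Literature.MathematicalPhysics.QuantumLattice.HubbardUmklappFold
import HarnessLib

/-!
# Four-sector counting on the band Fermi curve: uniform bounds and the level function (definitions)

Topic `Literature/MathematicalPhysics/QuantumLattice`; sub-namespace `BandSectorCounting`. The geometric and
combinatorial input of the single-scale isotropic four-sector counting lemma of Benfatto–Giuliani–Mastropietro
(Ann. Henri Poincaré 7 (2006), Lemma 3.1 / App. A2 (A2.0), `|A_h(ω₁;ω₂,ω₃,ω₄)| ≤ Cγ^{-h}|h|`) on the WHOLE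
hole-doped band `-4 < μ < 0` of `ε(k) = -2(cos k₁ + cos k₂)` and modulo `2πℤ²` (continued in `HubbardBandSectorCountingToolbox.lean` and
`HubbardBandSectorCountingCounts.lean`; the summit-side statement is the stub `stub_fourSectorCount` of
`Summits/HubbardSuperconductivity`):

* the two-variable dispersion `eps2 x y = -2(cos x + cos y)` and the level function of three curve points
  `hfun μ θ₁ θ₂ θ₃ = eps2 (Σ bandX) (Σ bandY) - μ` with its partials `h3`, `h33` and the anti-diagonal
  combination `Gfun` (definitions with bodies; their calculus is in `HubbardBandSectorCountingToolbox.lean`);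
* `BandBounds a b` — the bundle of uniform geometric constants of the band Fermi curve `u_μ(θ)(cos θ, sin θ)`
  for `μ ∈ [a, b] ⊂ (-4, 0)` (radius, speed, acceleration, strict convexity `cos x·x'² + cos y·y'² ≥ h_min`,
  Gauss-map rate, gradient, normal coefficient, radial transversality) and its CONSTRUCTION `bandBounds` with every
  constant explicit in `a, b` (`cQ, cU1, …, cDtmin`), from the whole-band curve geometry of
  `HubbardFermiRadiusBand*`, `HubbardFermiBandCurvature`, `HubbardUmklappFold`; the derived constants `Cg`
  (Gauss) and `Dcell` (cell).

Everything is PROVED. [folklore] elementary real analysis on the explicit dispersion; the counting scheme follows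
BGM 2006 App. A2 and BGM 2003 §7 (Lemmas 7.2–7.5).

## Sources

* G. Benfatto, A. Giuliani, V. Mastropietro, Ann. Henri Poincaré 7 (2006) 809–898, Lemma 3.1, App. A2.
  [BenfattoGiulianiMastropietro2006]
* G. Benfatto, A. Giuliani, V. Mastropietro, Ann. Henri Poincaré 4 (2003) 137–193, §7. [BenfattoGiulianiMastropietro2003]
-/

noncomputable section

open Real Set
open Literature.MathematicalPhysics.QuantumLattice

namespace Literature.MathematicalPhysics.QuantumLattice.BandSectorCounting

/-! ### The two-variable dispersion and the level function of three curve points -/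

/-- `ε₂(x, y) = -2 (cos x + cos y)`: the square-lattice dispersion `sqDispersion` (which takes a vector
`k : Fin 2 → ℝ`) as a function of the two real coordinates — a calculus-friendly abbreviation, see
`sqDispersion_eq_eps2`; not a new notion. [folklore] -/
def eps2 (x y : ℝ) : ℝ := -2 * (Real.cos x + Real.cos y)

/-- `ε(k) = ε₂(k₀, k₁)`. [folklore] -/
@[simp] theorem sqDispersion_eq_eps2 (k : Fin 2 → ℝ) : sqDispersion k = eps2 (k 0) (k 1) := by
  simp [sqDispersion, eps2]

/-- `ε₂` is `2`-Lipschitz in each variable. [folklore] -/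
theorem abs_eps2_sub_eps2_le (x y x' y' : ℝ) : |eps2 x y - eps2 x' y'| ≤ 2 * (|x - x'| + |y - y'|) := by
  unfold eps2
  have h1 := Real.abs_cos_sub_cos_le x x'
  have h2 := Real.abs_cos_sub_cos_le y y'
  calc |-2 * (Real.cos x + Real.cos y) - -2 * (Real.cos x' + Real.cos y')|
      = 2 * |(Real.cos x - Real.cos x') + (Real.cos y - Real.cos y')| := by
        rw [show -2 * (Real.cos x + Real.cos y) - -2 * (Real.cos x' + Real.cos y') =
          (-2) * ((Real.cos x - Real.cos x') + (Real.cos y - Real.cos y')) by ring, abs_mul]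
        norm_num
    _ ≤ 2 * (|Real.cos x - Real.cos x'| + |Real.cos y - Real.cos y'|) := by
        gcongr; exact abs_add_le _ _
    _ ≤ 2 * (|x - x'| + |y - y'|) := by gcongr

/-- `ε₂` is `2π`-periodic in each variable. [folklore] -/
theorem eps2_sub_int_mul (x y : ℝ) (m₀ m₁ : ℤ) :
    eps2 (x - m₀ * (2 * π)) (y - m₁ * (2 * π)) = eps2 x y := by
  unfold eps2; rw [Real.cos_sub_int_mul_two_pi, Real.cos_sub_int_mul_two_pi]

/-- `ε₂` is even. [folklore] -/
theorem eps2_neg (x y : ℝ) : eps2 (-x) (-y) = eps2 x y := by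
  unfold eps2; rw [Real.cos_neg, Real.cos_neg]

/-- The curve lies on the level: `ε₂(X, Y) = μ`. [folklore] -/
theorem eps2_bandXY {μ : ℝ} (hμ₁ : -4 < μ) (hμ₂ : μ < 0) (θ : ℝ) : eps2 (bandX μ θ) (bandY μ θ) = μ :=
  sqDispersion_bandXY hμ₁ hμ₂ θ

/-- Reduction modulo `2π` into `[-π, π]`. [folklore] -/
theorem exists_int_abs_sub_le_pi (x : ℝ) : ∃ m : ℤ, |x - m * (2 * π)| ≤ π := by
  refine ⟨toIcoDiv Real.two_pi_pos (-π) x, ?_⟩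
  have h := toIcoMod_mem_Ico Real.two_pi_pos (-π) x
  rw [← self_sub_toIcoDiv_zsmul Real.two_pi_pos (-π) x, zsmul_eq_mul] at h
  rw [abs_le]; constructor <;> linarith [h.1, h.2]

/-! ### The level function of three curve points and its derivatives -/

/-- `S_x = X(θ₁) + X(θ₂) + X(θ₃)`. [folklore] -/
def SX (μ θ₁ θ₂ θ₃ : ℝ) : ℝ := bandX μ θ₁ + bandX μ θ₂ + bandX μ θ₃

/-- `S_y = Y(θ₁) + Y(θ₂) + Y(θ₃)`. [folklore] -/
def SY (μ θ₁ θ₂ θ₃ : ℝ) : ℝ := bandY μ θ₁ + bandY μ θ₂ + bandY μ θ₃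

/-- **The level function** `h(θ₂, θ₃) = ε₂(p(θ₁) + p(θ₂) + p(θ₃)) - μ`. [folklore] -/
def hfun (μ θ₁ θ₂ θ₃ : ℝ) : ℝ := eps2 (SX μ θ₁ θ₂ θ₃) (SY μ θ₁ θ₂ θ₃) - μ

/-- `∂₃ h = 2 sin S_x · X'(θ₃) + 2 sin S_y · Y'(θ₃)`. [folklore] -/
def h3 (μ θ₁ θ₂ θ₃ : ℝ) : ℝ :=
  2 * Real.sin (SX μ θ₁ θ₂ θ₃) * bandVX μ θ₃ + 2 * Real.sin (SY μ θ₁ θ₂ θ₃) * bandVY μ θ₃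

/-- `∂₃∂₃ h`. [folklore] -/
def h33 (μ θ₁ θ₂ θ₃ : ℝ) : ℝ :=
  2 * (Real.cos (SX μ θ₁ θ₂ θ₃) * bandVX μ θ₃ * bandVX μ θ₃ + Real.sin (SX μ θ₁ θ₂ θ₃) * bandAX μ θ₃) +
  2 * (Real.cos (SY μ θ₁ θ₂ θ₃) * bandVY μ θ₃ * bandVY μ θ₃ + Real.sin (SY μ θ₁ θ₂ θ₃) * bandAY μ θ₃)

/-- Symmetry of `S_x`. [folklore] -/
theorem SX_swap (μ θ₁ θ₂ θ₃ : ℝ) : SX μ θ₁ θ₂ θ₃ = SX μ θ₁ θ₃ θ₂ := by unfold SX; ring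

/-- Symmetry of `S_y`. [folklore] -/
theorem SY_swap (μ θ₁ θ₂ θ₃ : ℝ) : SY μ θ₁ θ₂ θ₃ = SY μ θ₁ θ₃ θ₂ := by unfold SY; ring

/-- Symmetry of `h`. [folklore] -/
theorem hfun_swap (μ θ₁ θ₂ θ₃ : ℝ) : hfun μ θ₁ θ₂ θ₃ = hfun μ θ₁ θ₃ θ₂ := by
  unfold hfun; rw [SX_swap, SY_swap]

/-- `G(t) = (∂₂ + ∂₃) h` along the anti-diagonal `(σ - t/2, σ + t/2)`:
`2 sin S_x (X'₋ + X'₊) + 2 sin S_y (Y'₋ + Y'₊)`. [folklore] -/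
def Gfun (μ θ₁ σ s : ℝ) : ℝ :=
  2 * (Real.sin (SX μ θ₁ (σ - s / 2) (σ + s / 2)) * (bandVX μ (σ - s / 2) + bandVX μ (σ + s / 2))) +
    2 * (Real.sin (SY μ θ₁ (σ - s / 2) (σ + s / 2)) * (bandVY μ (σ - s / 2) + bandVY μ (σ + s / 2)))

/-! ### The bundle of uniform constants -/

/-- Uniform geometric constants of the band Fermi curve for levels `μ ∈ [a, b] ⊂ (-4, 0)`. [folklore] -/
structure BandBounds (a b : ℝ) where
  /-- the level range is inside the band -/
  ha : -4 < a
  /-- the level range is inside the band -/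
  hb : b < 0
  /-- lower bound of the radius -/
  umin : ℝ
  /-- speed bound -/
  smax : ℝ
  /-- acceleration bound -/
  A2 : ℝ
  /-- strict convexity constant -/
  hmin : ℝ
  /-- Gauss-map rate -/
  amin : ℝ
  /-- gradient lower bound -/
  rhomin : ℝ
  /-- normal-coefficient upper bound -/
  cmax : ℝ
  /-- radial transversality constant -/
  Dtmin : ℝ
  /-- positivity of the radius bound -/
  umin_pos : 0 < umin
  /-- positivity of the speed bound -/
  smax_pos : 0 < smax
  /-- positivity of the acceleration bound -/
  A2_pos : 0 < A2
  /-- positivity of the convexity constant -/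
  hmin_pos : 0 < hmin
  /-- positivity of the Gauss-map rate -/
  amin_pos : 0 < amin
  /-- positivity of the gradient bound -/
  rhomin_pos : 0 < rhomin
  /-- positivity of the normal-coefficient bound -/
  cmax_pos : 0 < cmax
  /-- positivity of the radial transversality constant -/
  Dtmin_pos : 0 < Dtmin
  /-- `u_min ≤ u` -/
  umin_le : ∀ μ ∈ Icc a b, ∀ θ, umin ≤ bandFermiRadius μ θ
  /-- `|x'| ≤ s_max` -/
  abs_VX_le : ∀ μ ∈ Icc a b, ∀ θ, |bandVX μ θ| ≤ smax
  /-- `|y'| ≤ s_max` -/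
  abs_VY_le : ∀ μ ∈ Icc a b, ∀ θ, |bandVY μ θ| ≤ smax
  /-- `|x''| ≤ A₂` -/
  abs_AX_le : ∀ μ ∈ Icc a b, ∀ θ, |bandAX μ θ| ≤ A2
  /-- `|y''| ≤ A₂` -/
  abs_AY_le : ∀ μ ∈ Icc a b, ∀ θ, |bandAY μ θ| ≤ A2
  /-- strict convexity: `h_min ≤ cos x·x'² + cos y·y'²` -/
  hess_ge : ∀ μ ∈ Icc a b, ∀ θ,
    hmin ≤ Real.cos (bandX μ θ) * bandVX μ θ ^ 2 + Real.cos (bandY μ θ) * bandVY μ θ ^ 2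
  /-- the Gauss map expands: `a_min |θ - θ'| ≤ |α(θ) - α(θ')|` -/
  gauss : ∀ μ ∈ Icc a b, ∀ θ θ', amin * |θ - θ'| ≤ |bandNormalAngle μ θ - bandNormalAngle μ θ'|
  /-- `ρ_min ≤ √(sin² x + sin² y)` -/
  rho_ge : ∀ μ ∈ Icc a b, ∀ θ,
    rhomin ≤ Real.sqrt (Real.sin (bandX μ θ) ^ 2 + Real.sin (bandY μ θ) ^ 2)
  /-- `c ≤ c_max` -/
  c_le : ∀ μ ∈ Icc a b, ∀ θ, bandNormalCoeff μ θ ≤ cmax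
  /-- `Dt_min ≤ ∂_t F(θ, u)` -/
  Dt_ge : ∀ μ ∈ Icc a b, ∀ θ, Dtmin ≤ rayDispersionDt θ (bandFermiRadius μ θ)

namespace BandBounds

/-- Levels of the range lie in the band. [folklore] -/
theorem level {a b : ℝ} (B : BandBounds a b) {μ : ℝ} (hμ : μ ∈ Icc a b) : -4 < μ ∧ μ < 0 :=
  ⟨B.ha.trans_le hμ.1, hμ.2.trans_lt B.hb⟩

/-- The Gauss constant `C_g = π c_max / (2 a_min ρ_min²)`. [folklore] -/
def Cg {a b : ℝ} (B : BandBounds a b) : ℝ := π * B.cmax / (2 * B.amin * B.rhomin ^ 2)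

/-- `0 < C_g`. [folklore] -/
theorem Cg_pos {a b : ℝ} (B : BandBounds a b) : 0 < B.Cg := by
  have := B.cmax_pos; have := B.amin_pos; have := B.rhomin_pos
  unfold Cg; positivity

end BandBounds

/-- The cell constant `D = 1/Dt_min + s_max/2`. [folklore] -/
def BandBounds.Dcell {a b : ℝ} (B : BandBounds a b) : ℝ := 1 / B.Dtmin + B.smax / 2

/-- `0 < D`. [folklore] -/
theorem BandBounds.Dcell_pos {a b : ℝ} (B : BandBounds a b) : 0 < B.Dcell := by
  have := B.Dtmin_pos; have := B.smax_pos; unfold BandBounds.Dcell; positivity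

/-! ### Elementary trigonometric bounds -/

/-- `sin x ≥ (sin K / K) x` for `0 ≤ x ≤ K ≤ π`, `0 < K` (concavity of `sin` on `[0, π]`). [folklore] -/
theorem sin_ge_chord {K x : ℝ} (hK : 0 < K) (hKπ : K ≤ π) (hx0 : 0 ≤ x) (hxK : x ≤ K) :
    Real.sin K / K * x ≤ Real.sin x := by
  have hconc := strictConcaveOn_sin_Icc.concaveOn
  have h0 : (0 : ℝ) ∈ Icc 0 π := ⟨le_rfl, Real.pi_pos.le⟩
  have hKm : K ∈ Icc 0 π := ⟨hK.le, hKπ⟩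
  have ha : 0 ≤ 1 - x / K := by rw [sub_nonneg, div_le_one hK]; exact hxK
  have hb : 0 ≤ x / K := div_nonneg hx0 hK.le
  have h := hconc.2 h0 hKm ha hb (by ring)
  simp only [smul_eq_mul, mul_zero, zero_add, Real.sin_zero] at h
  have hx : x / K * K = x := div_mul_cancel₀ x hK.ne'
  rw [hx] at h
  calc Real.sin K / K * x = x / K * Real.sin K := by ring
    _ ≤ Real.sin x := h

/-- `x sin x ≥ (sin K / K) x²` for `|x| ≤ K ≤ π`, `0 < K`. [folklore] -/
theorem mul_sin_ge_chord_sq {K x : ℝ} (hK : 0 < K) (hKπ : K ≤ π) (hx : |x| ≤ K) :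
    Real.sin K / K * x ^ 2 ≤ x * Real.sin x := by
  rcases le_or_gt 0 x with h | h
  · have h1 := sin_ge_chord hK hKπ h (by rwa [abs_of_nonneg h] at hx)
    calc Real.sin K / K * x ^ 2 = x * (Real.sin K / K * x) := by ring
      _ ≤ x * Real.sin x := mul_le_mul_of_nonneg_left h1 h
  · have h' : 0 ≤ -x := by linarith
    have h1 := sin_ge_chord hK hKπ h' (by rwa [abs_of_neg h] at hx)
    rw [Real.sin_neg] at h1
    calc Real.sin K / K * x ^ 2 = (-x) * (Real.sin K / K * (-x)) := by ring
      _ ≤ (-x) * (-Real.sin x) := mul_le_mul_of_nonneg_left h1 h'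
      _ = x * Real.sin x := by ring

/-! ### The coordinate radius `K_b` -/

/-- `K(μ)` is monotone in `μ`. [folklore] -/
theorem umklappRadius_mono {μ ν : ℝ} (h : μ ≤ ν) : umklappRadius μ ≤ umklappRadius ν := by
  unfold umklappRadius
  exact Real.antitone_arccos (by linarith)

/-- `0 < K(μ)` for `-4 < μ`. [folklore] -/
theorem umklappRadius_pos {μ : ℝ} (hμ : -4 < μ) : 0 < umklappRadius μ := by
  unfold umklappRadius
  rw [Real.arccos_pos]; linarith

section Level

variable {μ : ℝ} (hμ₁ : -4 < μ) (hμ₂ : μ < 0)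
include hμ₁ hμ₂

/-- The curve in coordinates: `sqDispersion ![X, Y] = μ`. [folklore] -/
theorem sqDispersion_vec_bandXY (θ : ℝ) : sqDispersion ![bandX μ θ, bandY μ θ] = μ := by
  have h := sqDispersion_bandXY hμ₁ hμ₂ θ
  simpa [sqDispersion] using h

/-- `|X| < π`, `|Y| < π`. [folklore] -/
theorem abs_bandX_lt_pi (θ : ℝ) : |bandX μ θ| < π := by
  have := abs_fermiPolar_apply_lt hμ₁ hμ₂ θ 0
  simpa [bandX] using this

/-- `|Y| < π`. [folklore] -/
theorem abs_bandY_lt_pi (θ : ℝ) : |bandY μ θ| < π := by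
  have := abs_fermiPolar_apply_lt hμ₁ hμ₂ θ 1
  simpa [bandY] using this

/-- `|X| ≤ K(μ)`. [folklore] -/
theorem abs_bandX_le_umklappRadius (θ : ℝ) : |bandX μ θ| ≤ umklappRadius μ := by
  have hk : ∀ i, |(![bandX μ θ, bandY μ θ] : Fin 2 → ℝ) i| ≤ π := by
    intro i; fin_cases i
    · simpa using (abs_bandX_lt_pi hμ₁ hμ₂ θ).le
    · simpa using (abs_bandY_lt_pi hμ₁ hμ₂ θ).le
  have := abs_le_umklappRadius_of_sqDispersion_eq hk (sqDispersion_vec_bandXY hμ₁ hμ₂ θ) 0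
  simpa using this

/-- `|Y| ≤ K(μ)`. [folklore] -/
theorem abs_bandY_le_umklappRadius (θ : ℝ) : |bandY μ θ| ≤ umklappRadius μ := by
  have hk : ∀ i, |(![bandX μ θ, bandY μ θ] : Fin 2 → ℝ) i| ≤ π := by
    intro i; fin_cases i
    · simpa using (abs_bandX_lt_pi hμ₁ hμ₂ θ).le
    · simpa using (abs_bandY_lt_pi hμ₁ hμ₂ θ).le
  have := abs_le_umklappRadius_of_sqDispersion_eq hk (sqDispersion_vec_bandXY hμ₁ hμ₂ θ) 1
  simpa using this

omit hμ₁ hμ₂ in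
/-- `u² = X² + Y²`. [folklore] -/
theorem bandFermiRadius_sq (θ : ℝ) : bandFermiRadius μ θ ^ 2 = bandX μ θ ^ 2 + bandY μ θ ^ 2 := by
  have := Real.cos_sq_add_sin_sq θ
  simp only [bandX, bandY]; nlinarith [this]

/-- `u ≥ √(μ + 4)`. [folklore] -/
theorem sqrt_le_bandFermiRadius (θ : ℝ) : Real.sqrt (μ + 4) ≤ bandFermiRadius μ θ := by
  have h := sqDispersion_add_four_le ![bandX μ θ, bandY μ θ]
  rw [sqDispersion_vec_bandXY hμ₁ hμ₂ θ] at h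
  simp only [Matrix.cons_val_zero, Matrix.cons_val_one] at h
  rw [← bandFermiRadius_sq θ] at h
  calc Real.sqrt (μ + 4) ≤ Real.sqrt (bandFermiRadius μ θ ^ 2) := Real.sqrt_le_sqrt h
    _ = bandFermiRadius μ θ := Real.sqrt_sq (bandFermiRadius_pos hμ₁ hμ₂ θ).le

/-- `u ≤ 5` (the curve lies in the square `(-π, π)²`). [folklore] -/
theorem bandFermiRadius_le_five (θ : ℝ) : bandFermiRadius μ θ ≤ 5 := by
  have hx := abs_bandX_lt_pi hμ₁ hμ₂ θ
  have hy := abs_bandY_lt_pi hμ₁ hμ₂ θ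
  have hsq := bandFermiRadius_sq (μ := μ) θ
  have hπ : π < 3.15 := Real.pi_lt_d2
  have hu := bandFermiRadius_pos hμ₁ hμ₂ θ
  have hx2 : bandX μ θ ^ 2 < 3.15 ^ 2 := by
    have := abs_lt.1 hx; nlinarith
  have hy2 : bandY μ θ ^ 2 < 3.15 ^ 2 := by
    have := abs_lt.1 hy; nlinarith
  nlinarith

/-- `|∂_θ F(θ, u)| ≤ 4u`. [folklore] -/
theorem abs_rayDispersionDθ_le (θ : ℝ) :
    |rayDispersionDθ θ (bandFermiRadius μ θ)| ≤ 4 * bandFermiRadius μ θ := by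
  have hu := bandFermiRadius_pos hμ₁ hμ₂ θ
  unfold rayDispersionDθ
  have h1 := Real.abs_cos_le_one θ; have h2 := Real.abs_sin_le_one θ
  have h3 := Real.abs_sin_le_one (bandFermiRadius μ θ * Real.sin θ)
  have h4 := Real.abs_sin_le_one (bandFermiRadius μ θ * Real.cos θ)
  have hin : |Real.cos θ * Real.sin (bandFermiRadius μ θ * Real.sin θ) -
      Real.sin θ * Real.sin (bandFermiRadius μ θ * Real.cos θ)| ≤ 2 := by
    calc _ ≤ |Real.cos θ * Real.sin (bandFermiRadius μ θ * Real.sin θ)| +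
          |Real.sin θ * Real.sin (bandFermiRadius μ θ * Real.cos θ)| := abs_sub _ _
      _ ≤ 1 + 1 := by
          rw [abs_mul, abs_mul]
          exact add_le_add (mul_le_one₀ h1 (abs_nonneg _) h3) (mul_le_one₀ h2 (abs_nonneg _) h4)
      _ = 2 := by norm_num
  rw [abs_mul, abs_mul, abs_of_pos (by norm_num : (0:ℝ) < 2), abs_of_pos hu]
  nlinarith [abs_nonneg (Real.cos θ * Real.sin (bandFermiRadius μ θ * Real.sin θ) -
      Real.sin θ * Real.sin (bandFermiRadius μ θ * Real.cos θ))]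

/-- `c ≤ 2 / u`. [folklore] -/
theorem bandNormalCoeff_le (θ : ℝ) : bandNormalCoeff μ θ ≤ 2 / bandFermiRadius μ θ := by
  have hu := bandFermiRadius_pos hμ₁ hμ₂ θ
  have hDt4 : rayDispersionDt θ (bandFermiRadius μ θ) ≤ 4 := by
    unfold rayDispersionDt
    have h1 := Real.abs_cos_le_one θ; have h2 := Real.abs_sin_le_one θ
    have h3 := Real.abs_sin_le_one (bandFermiRadius μ θ * Real.cos θ)
    have h4 := Real.abs_sin_le_one (bandFermiRadius μ θ * Real.sin θ)
    have e1 : Real.cos θ * Real.sin (bandFermiRadius μ θ * Real.cos θ) ≤ 1 := by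
      have := abs_mul (Real.cos θ) (Real.sin (bandFermiRadius μ θ * Real.cos θ))
      have := mul_le_one₀ h1 (abs_nonneg _) h3
      linarith [le_abs_self (Real.cos θ * Real.sin (bandFermiRadius μ θ * Real.cos θ))]
    have e2 : Real.sin θ * Real.sin (bandFermiRadius μ θ * Real.sin θ) ≤ 1 := by
      have := abs_mul (Real.sin θ) (Real.sin (bandFermiRadius μ θ * Real.sin θ))
      have := mul_le_one₀ h2 (abs_nonneg _) h4
      linarith [le_abs_self (Real.sin θ * Real.sin (bandFermiRadius μ θ * Real.sin θ))]
    linarith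
  rw [bandNormalCoeff, div_le_div_iff₀ (by positivity) hu]
  nlinarith

/-- `c · (x'y'' - y'x'') = cos x x'² + cos y y'²`. [folklore] -/
theorem bandNormalCoeff_mul_cross (θ : ℝ) :
    bandNormalCoeff μ θ * (bandVX μ θ * bandAY μ θ - bandVY μ θ * bandAX μ θ) =
      Real.cos (bandX μ θ) * bandVX μ θ ^ 2 + Real.cos (bandY μ θ) * bandVY μ θ ^ 2 := by
  have hE := bandHess_add_grad_dot_acc hμ₁ hμ₂ θ
  rw [sin_bandX_eq hμ₁ hμ₂, sin_bandY_eq hμ₁ hμ₂] at hE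
  linear_combination -hE

omit hμ₁ hμ₂ in
/-- `x'² + y'² = u'² + u²`. [folklore] -/
theorem bandVX_sq_add_bandVY_sq (θ : ℝ) :
    bandVX μ θ ^ 2 + bandVY μ θ ^ 2 = bandFermiRadiusDeriv μ θ ^ 2 + bandFermiRadius μ θ ^ 2 := by
  have := Real.cos_sq_add_sin_sq θ
  simp only [bandVX, bandVY]; nlinarith [this]

omit hμ₁ hμ₂ in
/-- The Hessian numerator is at most `u'² + u²`. [folklore] -/
theorem bandHess_le (θ : ℝ) :
    Real.cos (bandX μ θ) * bandVX μ θ ^ 2 + Real.cos (bandY μ θ) * bandVY μ θ ^ 2 ≤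
      bandFermiRadiusDeriv μ θ ^ 2 + bandFermiRadius μ θ ^ 2 := by
  rw [← bandVX_sq_add_bandVY_sq θ]
  have h1 := Real.cos_le_one (bandX μ θ); have h2 := Real.cos_le_one (bandY μ θ)
  nlinarith [sq_nonneg (bandVX μ θ), sq_nonneg (bandVY μ θ)]

/-- **`|u''|` is bounded** in terms of `u, u'` and `c`: `u |u''| ≤ u² + 2u'² + (u'² + u²)/c`.
[folklore] -/
theorem mul_abs_bandRadiusDeriv2_le (θ : ℝ) :
    bandFermiRadius μ θ * |bandRadiusDeriv2 μ θ| ≤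
      bandFermiRadius μ θ ^ 2 + 2 * bandFermiRadiusDeriv μ θ ^ 2 +
        (bandFermiRadiusDeriv μ θ ^ 2 + bandFermiRadius μ θ ^ 2) / bandNormalCoeff μ θ := by
  have hu := bandFermiRadius_pos hμ₁ hμ₂ θ
  have hc := bandNormalCoeff_pos hμ₁ hμ₂ θ
  have hpolar := bandCross_eq_polar μ θ
  have hcc := bandNormalCoeff_mul_cross hμ₁ hμ₂ θ
  have hHpos := bandHess_pos hμ₁ hμ₂ θ
  have hHle := bandHess_le (μ := μ) θ
  set cross := bandVX μ θ * bandAY μ θ - bandVY μ θ * bandAX μ θ with hcross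
  have hcross_pos : 0 < cross := bandCross_pos hμ₁ hμ₂ θ
  have hcross_le : cross ≤ (bandFermiRadiusDeriv μ θ ^ 2 + bandFermiRadius μ θ ^ 2) / bandNormalCoeff μ θ := by
    rw [le_div_iff₀ hc]; nlinarith
  have hprod : bandFermiRadius μ θ * bandRadiusDeriv2 μ θ =
      bandFermiRadius μ θ ^ 2 + 2 * bandFermiRadiusDeriv μ θ ^ 2 - cross := by
    linarith [hpolar]
  rw [← abs_of_pos hu, ← abs_mul, abs_of_pos hu, hprod, abs_le]
  constructor
  · nlinarith [sq_nonneg (bandFermiRadiusDeriv μ θ), sq_nonneg (bandFermiRadius μ θ)]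
  · nlinarith [sq_nonneg (bandFermiRadiusDeriv μ θ), sq_nonneg (bandFermiRadius μ θ)]

/-- `ρ² = c² (u'² + u²)`. [folklore] -/
theorem rho_sq_eq (θ : ℝ) :
    Real.sin (bandX μ θ) ^ 2 + Real.sin (bandY μ θ) ^ 2 =
      bandNormalCoeff μ θ ^ 2 * (bandFermiRadiusDeriv μ θ ^ 2 + bandFermiRadius μ θ ^ 2) := by
  rw [sin_bandX_eq hμ₁ hμ₂, sin_bandY_eq hμ₁ hμ₂, ← bandVX_sq_add_bandVY_sq θ]; ring

/-- **The Gauss map rate from below**: `α' = (x'y'' - y'x'')/(u² + u'²) ≥ Hess/(c (u² + u'²))`.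
[folklore] -/
theorem bandNormalAngleDeriv_eq_hess_div (θ : ℝ) :
    bandNormalAngleDeriv μ θ =
      (Real.cos (bandX μ θ) * bandVX μ θ ^ 2 + Real.cos (bandY μ θ) * bandVY μ θ ^ 2) /
        (bandNormalCoeff μ θ * (bandFermiRadius μ θ ^ 2 + bandFermiRadiusDeriv μ θ ^ 2)) := by
  have hc := bandNormalCoeff_pos hμ₁ hμ₂ θ
  have hu := bandFermiRadius_pos hμ₁ hμ₂ θ
  rw [bandNormalAngleDeriv, ← bandCross_eq_polar, ← bandNormalCoeff_mul_cross hμ₁ hμ₂ θ]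
  field_simp

end Level

/-! ### The bundle of uniform constants -/

/-! ### Explicit constants on a level range `[a, b]` -/

/-- `q_b = sin K_b / K_b`. [folklore] -/
def cQ (b : ℝ) : ℝ := Real.sin (umklappRadius b) / umklappRadius b

/-- `U₁ = 2 K_b / sin K_b` (bound on `|u'|`). [folklore] -/
def cU1 (b : ℝ) : ℝ := 2 * umklappRadius b / Real.sin (umklappRadius b)

/-- `u_min = √(a + 4)`. [folklore] -/
def cUmin (a : ℝ) : ℝ := Real.sqrt (a + 4)

/-- `c_max = 2 / u_min`. [folklore] -/
def cCmax (a : ℝ) : ℝ := 2 / cUmin a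

/-- `s_max = U₁ + 5`. [folklore] -/
def cSmax (b : ℝ) : ℝ := cU1 b + 5

/-- `U₂` (bound on `|u''|`). [folklore] -/
def cU2 (a b : ℝ) : ℝ := (25 + 2 * cU1 b ^ 2 + (cU1 b ^ 2 + 25) / cQ b) / cUmin a

/-- `A₂ = U₂ + 2U₁ + 6` (bound on `|x''|, |y''|`). [folklore] -/
def cA2 (a b : ℝ) : ℝ := cU2 a b + 2 * cU1 b + 6

/-- `h₀ = (-b/2)(1 - a²/16)`. [folklore] -/
def cH0 (a b : ℝ) : ℝ := (-b / 2) * (1 - a ^ 2 / 16)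

/-- `h_min = h₀ / c_max²`. [folklore] -/
def cHmin (a b : ℝ) : ℝ := cH0 a b / cCmax a ^ 2

/-- `a_min = h_min / (c_max (25 + U₁²))`. [folklore] -/
def cAmin (a b : ℝ) : ℝ := cHmin a b / (cCmax a * (25 + cU1 b ^ 2))

/-- `ρ_min = q_b u_min`. [folklore] -/
def cRhomin (a b : ℝ) : ℝ := cQ b * cUmin a

/-- `Dt_min = 2 q_b u_min`. [folklore] -/
def cDtmin (a b : ℝ) : ℝ := 2 * cQ b * cUmin a

section Range

variable {a b : ℝ} (ha : -4 < a) (hab : a ≤ b) (hb : b < 0)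
include ha hab hb

/-- `0 < K_b < π`, `0 < sin K_b`. [folklore] -/
theorem umklappRadius_b_facts :
    0 < umklappRadius b ∧ umklappRadius b < π ∧ 0 < Real.sin (umklappRadius b) := by
  have h1 : 0 < umklappRadius b := umklappRadius_pos (by linarith)
  have h2 : umklappRadius b < π := umklappRadius_lt_pi hb
  exact ⟨h1, h2, Real.sin_pos_of_pos_of_lt_pi h1 h2⟩

/-- `0 < q_b`. [folklore] -/
theorem cQ_pos : 0 < cQ b := by
  obtain ⟨h1, _, h3⟩ := umklappRadius_b_facts ha hab hb
  exact div_pos h3 h1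

/-- `0 < U₁`. [folklore] -/
theorem cU1_pos : 0 < cU1 b := by
  obtain ⟨h1, _, h3⟩ := umklappRadius_b_facts ha hab hb
  unfold cU1; positivity

omit hab hb in
/-- `0 < u_min`. [folklore] -/
theorem cUmin_pos : 0 < cUmin a := Real.sqrt_pos.2 (by linarith)

omit hab hb in
/-- `0 < c_max`. [folklore] -/
theorem cCmax_pos : 0 < cCmax a := by
  have := cUmin_pos ha; unfold cCmax; positivity

omit hab in
/-- Levels of the range lie in the band. [folklore] -/
theorem level_mem {μ : ℝ} (hμ : μ ∈ Icc a b) : -4 < μ ∧ μ < 0 :=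
  ⟨by linarith [hμ.1], by linarith [hμ.2]⟩

/-- `2 q_b u ≤ ∂_t F(θ, u)`. [folklore] -/
theorem Dt_ge_q {μ : ℝ} (hμ : μ ∈ Icc a b) (θ : ℝ) :
    2 * cQ b * bandFermiRadius μ θ ≤ rayDispersionDt θ (bandFermiRadius μ θ) := by
  obtain ⟨hK1, hK2, hK3⟩ := umklappRadius_b_facts ha hab hb
  obtain ⟨h1, h2⟩ := level_mem ha hb hμ
  have hu := bandFermiRadius_pos h1 h2 θ
  have hXb : |bandX μ θ| ≤ umklappRadius b :=
    (abs_bandX_le_umklappRadius h1 h2 θ).trans (umklappRadius_mono hμ.2)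
  have hYb : |bandY μ θ| ≤ umklappRadius b :=
    (abs_bandY_le_umklappRadius h1 h2 θ).trans (umklappRadius_mono hμ.2)
  have hX := mul_sin_ge_chord_sq hK1 hK2.le hXb
  have hY := mul_sin_ge_chord_sq hK1 hK2.le hYb
  have hsq := bandFermiRadius_sq (μ := μ) θ
  have hid : bandFermiRadius μ θ * rayDispersionDt θ (bandFermiRadius μ θ) =
      2 * (bandX μ θ * Real.sin (bandX μ θ) + bandY μ θ * Real.sin (bandY μ θ)) := by
    simp only [rayDispersionDt, bandX, bandY]; ring
  have hq : cQ b * bandFermiRadius μ θ ^ 2 ≤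
      bandX μ θ * Real.sin (bandX μ θ) + bandY μ θ * Real.sin (bandY μ θ) := by
    calc cQ b * bandFermiRadius μ θ ^ 2 = cQ b * bandX μ θ ^ 2 + cQ b * bandY μ θ ^ 2 := by
          rw [hsq]; ring
      _ ≤ _ := add_le_add hX hY
  have h3 : bandFermiRadius μ θ * (2 * cQ b * bandFermiRadius μ θ) ≤
      bandFermiRadius μ θ * rayDispersionDt θ (bandFermiRadius μ θ) := by
    rw [hid]; nlinarith [hq]
  exact le_of_mul_le_mul_left h3 hu

omit hab in
/-- `u_min ≤ u`. [folklore] -/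
theorem cUmin_le {μ : ℝ} (hμ : μ ∈ Icc a b) (θ : ℝ) : cUmin a ≤ bandFermiRadius μ θ := by
  obtain ⟨h1, h2⟩ := level_mem ha hb hμ
  calc cUmin a = Real.sqrt (a + 4) := rfl
    _ ≤ Real.sqrt (μ + 4) := Real.sqrt_le_sqrt (by linarith [hμ.1])
    _ ≤ bandFermiRadius μ θ := sqrt_le_bandFermiRadius h1 h2 θ

omit hab in
/-- `u ≤ 5`. [folklore] -/
theorem u_le_five {μ : ℝ} (hμ : μ ∈ Icc a b) (θ : ℝ) : bandFermiRadius μ θ ≤ 5 :=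
  bandFermiRadius_le_five (level_mem ha hb hμ).1 (level_mem ha hb hμ).2 θ

/-- `|u'| ≤ U₁`. [folklore] -/
theorem abs_deriv_le_cU1 {μ : ℝ} (hμ : μ ∈ Icc a b) (θ : ℝ) : |bandFermiRadiusDeriv μ θ| ≤ cU1 b := by
  obtain ⟨hK1, hK2, hK3⟩ := umklappRadius_b_facts ha hab hb
  obtain ⟨h1, h2⟩ := level_mem ha hb hμ
  have hu := bandFermiRadius_pos h1 h2 θ
  have hDtpos : 0 < rayDispersionDt θ (bandFermiRadius μ θ) := rayDispersionDt_bandFermiRadius_pos h1 h2 θ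
  have hDθ := abs_rayDispersionDθ_le h1 h2 θ
  have hDt' := Dt_ge_q ha hab hb hμ θ
  have hU1_pos := cU1_pos ha hab hb
  rw [bandFermiRadiusDeriv, abs_div, abs_neg, abs_of_pos hDtpos, div_le_iff₀ hDtpos]
  have hid : cU1 b * (2 * cQ b * bandFermiRadius μ θ) = 4 * bandFermiRadius μ θ := by
    unfold cU1 cQ; field_simp; norm_num
  calc |rayDispersionDθ θ (bandFermiRadius μ θ)| ≤ 4 * bandFermiRadius μ θ := hDθ
    _ = cU1 b * (2 * cQ b * bandFermiRadius μ θ) := hid.symm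
    _ ≤ cU1 b * rayDispersionDt θ (bandFermiRadius μ θ) := mul_le_mul_of_nonneg_left hDt' hU1_pos.le

/-- `q_b ≤ c`. [folklore] -/
theorem cQ_le_bandNormalCoeff {μ : ℝ} (hμ : μ ∈ Icc a b) (θ : ℝ) : cQ b ≤ bandNormalCoeff μ θ := by
  obtain ⟨h1, h2⟩ := level_mem ha hb hμ
  have hu := bandFermiRadius_pos h1 h2 θ
  rw [bandNormalCoeff, le_div_iff₀ (by positivity)]
  have := Dt_ge_q ha hab hb hμ θ; linarith

omit hab in
/-- `c ≤ c_max`. [folklore] -/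
theorem bandNormalCoeff_le_cCmax {μ : ℝ} (hμ : μ ∈ Icc a b) (θ : ℝ) : bandNormalCoeff μ θ ≤ cCmax a := by
  obtain ⟨h1, h2⟩ := level_mem ha hb hμ
  calc bandNormalCoeff μ θ ≤ 2 / bandFermiRadius μ θ := bandNormalCoeff_le h1 h2 θ
    _ ≤ 2 / cUmin a := div_le_div_of_nonneg_left (by norm_num) (cUmin_pos ha) (cUmin_le ha hb hμ θ)

/-- `|x'| ≤ s_max`. [folklore] -/
theorem abs_bandVX_le_cSmax {μ : ℝ} (hμ : μ ∈ Icc a b) (θ : ℝ) : |bandVX μ θ| ≤ cSmax b := by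
  obtain ⟨h1, h2⟩ := level_mem ha hb hμ
  have hu := bandFermiRadius_pos h1 h2 θ
  have e1 : |bandFermiRadiusDeriv μ θ * Real.cos θ| ≤ cU1 b := by
    rw [abs_mul]
    exact (mul_le_of_le_one_right (abs_nonneg _) (Real.abs_cos_le_one θ)).trans (abs_deriv_le_cU1 ha hab hb hμ θ)
  have e2 : |bandFermiRadius μ θ * Real.sin θ| ≤ 5 := by
    rw [abs_mul, abs_of_pos hu]
    exact (mul_le_of_le_one_right hu.le (Real.abs_sin_le_one θ)).trans (u_le_five ha hb hμ θ)
  calc |bandVX μ θ| ≤ |bandFermiRadiusDeriv μ θ * Real.cos θ| + |bandFermiRadius μ θ * Real.sin θ| :=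
        abs_sub _ _
    _ ≤ cSmax b := by unfold cSmax; linarith

/-- `|y'| ≤ s_max`. [folklore] -/
theorem abs_bandVY_le_cSmax {μ : ℝ} (hμ : μ ∈ Icc a b) (θ : ℝ) : |bandVY μ θ| ≤ cSmax b := by
  obtain ⟨h1, h2⟩ := level_mem ha hb hμ
  have hu := bandFermiRadius_pos h1 h2 θ
  have e1 : |bandFermiRadiusDeriv μ θ * Real.sin θ| ≤ cU1 b := by
    rw [abs_mul]
    exact (mul_le_of_le_one_right (abs_nonneg _) (Real.abs_sin_le_one θ)).trans (abs_deriv_le_cU1 ha hab hb hμ θ)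
  have e2 : |bandFermiRadius μ θ * Real.cos θ| ≤ 5 := by
    rw [abs_mul, abs_of_pos hu]
    exact (mul_le_of_le_one_right hu.le (Real.abs_cos_le_one θ)).trans (u_le_five ha hb hμ θ)
  calc |bandVY μ θ| ≤ |bandFermiRadiusDeriv μ θ * Real.sin θ| + |bandFermiRadius μ θ * Real.cos θ| :=
        abs_add_le _ _
    _ ≤ cSmax b := by unfold cSmax; linarith

/-- `|u''| ≤ U₂`. [folklore] -/
theorem abs_bandRadiusDeriv2_le_cU2 {μ : ℝ} (hμ : μ ∈ Icc a b) (θ : ℝ) : |bandRadiusDeriv2 μ θ| ≤ cU2 a b := by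
  obtain ⟨h1, h2⟩ := level_mem ha hb hμ
  have hu := bandFermiRadius_pos h1 h2 θ
  have hc := bandNormalCoeff_pos h1 h2 θ
  have hm := mul_abs_bandRadiusDeriv2_le h1 h2 θ
  have hu' := abs_deriv_le_cU1 ha hab hb hμ θ
  have hu5' := u_le_five ha hb hμ θ
  have hum := cUmin_le ha hb hμ θ
  have hqpos := cQ_pos ha hab hb
  have huminpos := cUmin_pos ha
  have hd2 : bandFermiRadiusDeriv μ θ ^ 2 ≤ cU1 b ^ 2 := by
    rw [← sq_abs]; exact pow_le_pow_left₀ (abs_nonneg _) hu' 2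
  have hu2 : bandFermiRadius μ θ ^ 2 ≤ 25 := by nlinarith
  have hfrac : (bandFermiRadiusDeriv μ θ ^ 2 + bandFermiRadius μ θ ^ 2) / bandNormalCoeff μ θ ≤
      (cU1 b ^ 2 + 25) / cQ b := by
    calc (bandFermiRadiusDeriv μ θ ^ 2 + bandFermiRadius μ θ ^ 2) / bandNormalCoeff μ θ
        ≤ (cU1 b ^ 2 + 25) / bandNormalCoeff μ θ := div_le_div_of_nonneg_right (by linarith) hc.le
      _ ≤ (cU1 b ^ 2 + 25) / cQ b :=
          div_le_div_of_nonneg_left (by positivity) hqpos (cQ_le_bandNormalCoeff ha hab hb hμ θ)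
  have hnum : bandFermiRadius μ θ * |bandRadiusDeriv2 μ θ| ≤ 25 + 2 * cU1 b ^ 2 + (cU1 b ^ 2 + 25) / cQ b := by
    linarith
  unfold cU2
  rw [le_div_iff₀ huminpos]
  calc |bandRadiusDeriv2 μ θ| * cUmin a ≤ |bandRadiusDeriv2 μ θ| * bandFermiRadius μ θ :=
        mul_le_mul_of_nonneg_left hum (abs_nonneg _)
    _ = bandFermiRadius μ θ * |bandRadiusDeriv2 μ θ| := mul_comm _ _
    _ ≤ _ := hnum

/-- `0 ≤ U₂`. [folklore] -/
theorem cU2_nonneg : 0 ≤ cU2 a b :=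
  (abs_nonneg _).trans (abs_bandRadiusDeriv2_le_cU2 ha hab hb (μ := a) ⟨le_rfl, hab⟩ 0)

/-- `0 < A₂`. [folklore] -/
theorem cA2_pos : 0 < cA2 a b := by
  have := cU2_nonneg ha hab hb; have := cU1_pos ha hab hb; unfold cA2; positivity

/-- `|x''| ≤ A₂`. [folklore] -/
theorem abs_bandAX_le_cA2 {μ : ℝ} (hμ : μ ∈ Icc a b) (θ : ℝ) : |bandAX μ θ| ≤ cA2 a b := by
  obtain ⟨h1, h2⟩ := level_mem ha hb hμ
  have hu := bandFermiRadius_pos h1 h2 θ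
  have hc' := Real.abs_cos_le_one θ; have hs' := Real.abs_sin_le_one θ
  have hU2 := abs_bandRadiusDeriv2_le_cU2 ha hab hb hμ θ
  have hU1 := abs_deriv_le_cU1 ha hab hb hμ θ
  have t1 : |bandRadiusDeriv2 μ θ * Real.cos θ| ≤ cU2 a b := by
    rw [abs_mul]; exact (mul_le_of_le_one_right (abs_nonneg _) hc').trans hU2
  have t2 : |2 * bandFermiRadiusDeriv μ θ * Real.sin θ| ≤ 2 * cU1 b := by
    rw [abs_mul, abs_mul, abs_of_pos (by norm_num : (0:ℝ) < 2)]
    calc 2 * |bandFermiRadiusDeriv μ θ| * |Real.sin θ| ≤ 2 * |bandFermiRadiusDeriv μ θ| :=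
          mul_le_of_le_one_right (by positivity) hs'
      _ ≤ 2 * cU1 b := by linarith
  have t3 : |bandFermiRadius μ θ * Real.cos θ| ≤ 5 := by
    rw [abs_mul, abs_of_pos hu]; exact (mul_le_of_le_one_right hu.le hc').trans (u_le_five ha hb hμ θ)
  have tri : |bandAX μ θ| ≤ |bandRadiusDeriv2 μ θ * Real.cos θ| + |2 * bandFermiRadiusDeriv μ θ * Real.sin θ| +
      |bandFermiRadius μ θ * Real.cos θ| := by
    rw [bandAX]; exact (abs_sub _ _).trans (add_le_add (abs_sub _ _) le_rfl)
  unfold cA2; linarith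

/-- `|y''| ≤ A₂`. [folklore] -/
theorem abs_bandAY_le_cA2 {μ : ℝ} (hμ : μ ∈ Icc a b) (θ : ℝ) : |bandAY μ θ| ≤ cA2 a b := by
  obtain ⟨h1, h2⟩ := level_mem ha hb hμ
  have hu := bandFermiRadius_pos h1 h2 θ
  have hc' := Real.abs_cos_le_one θ; have hs' := Real.abs_sin_le_one θ
  have hU2 := abs_bandRadiusDeriv2_le_cU2 ha hab hb hμ θ
  have hU1 := abs_deriv_le_cU1 ha hab hb hμ θ
  have t1 : |bandRadiusDeriv2 μ θ * Real.sin θ| ≤ cU2 a b := by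
    rw [abs_mul]; exact (mul_le_of_le_one_right (abs_nonneg _) hs').trans hU2
  have t2 : |2 * bandFermiRadiusDeriv μ θ * Real.cos θ| ≤ 2 * cU1 b := by
    rw [abs_mul, abs_mul, abs_of_pos (by norm_num : (0:ℝ) < 2)]
    calc 2 * |bandFermiRadiusDeriv μ θ| * |Real.cos θ| ≤ 2 * |bandFermiRadiusDeriv μ θ| :=
          mul_le_of_le_one_right (by positivity) hc'
      _ ≤ 2 * cU1 b := by linarith
  have t3 : |bandFermiRadius μ θ * Real.sin θ| ≤ 5 := by
    rw [abs_mul, abs_of_pos hu]; exact (mul_le_of_le_one_right hu.le hs').trans (u_le_five ha hb hμ θ)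
  have tri : |bandAY μ θ| ≤ |bandRadiusDeriv2 μ θ * Real.sin θ| + |2 * bandFermiRadiusDeriv μ θ * Real.cos θ| +
      |bandFermiRadius μ θ * Real.sin θ| := by
    rw [bandAY]; exact (abs_sub _ _).trans (add_le_add (abs_add_le _ _) le_rfl)
  unfold cA2; linarith

/-- `0 < h_min`. [folklore] -/
theorem cHmin_pos : 0 < cHmin a b := by
  have ha2 : a ^ 2 < 16 := by nlinarith
  have h0 : 0 < cH0 a b := mul_pos (by linarith) (by nlinarith)
  have := cCmax_pos ha
  unfold cHmin; positivity

/-- **Uniform strict convexity**: `h_min ≤ cos x·x'² + cos y·y'²`. [folklore] -/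
theorem cHmin_le_hess {μ : ℝ} (hμ : μ ∈ Icc a b) (θ : ℝ) :
    cHmin a b ≤ Real.cos (bandX μ θ) * bandVX μ θ ^ 2 + Real.cos (bandY μ θ) * bandVY μ θ ^ 2 := by
  obtain ⟨h1, h2⟩ := level_mem ha hb hμ
  have hG := bandNormalCoeff_sq_mul_bandHess_ge h1 h2 θ
  have hc := bandNormalCoeff_pos h1 h2 θ
  have hcm := bandNormalCoeff_le_cCmax ha hb hμ θ
  have hHpos := bandHess_pos h1 h2 θ
  have hμ2 : μ ^ 2 ≤ a ^ 2 := by nlinarith [hμ.1, hμ.2]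
  have ha2 : a ^ 2 < 16 := by nlinarith
  have hlow : cH0 a b ≤ -μ / 2 * (1 - μ ^ 2 / 16) := by
    unfold cH0
    exact mul_le_mul (by linarith [hμ.2]) (by nlinarith) (by nlinarith) (by linarith [hμ.2])
  have hc2 : bandNormalCoeff μ θ ^ 2 ≤ cCmax a ^ 2 := pow_le_pow_left₀ hc.le hcm 2
  have hcmaxpos := cCmax_pos ha
  unfold cHmin
  rw [div_le_iff₀ (by positivity)]
  calc cH0 a b ≤ bandNormalCoeff μ θ ^ 2 *
        (Real.cos (bandX μ θ) * bandVX μ θ ^ 2 + Real.cos (bandY μ θ) * bandVY μ θ ^ 2) := hlow.trans hG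
    _ ≤ _ := by rw [mul_comm]; exact mul_le_mul_of_nonneg_left hc2 hHpos.le

/-- `0 < a_min`. [folklore] -/
theorem cAmin_pos : 0 < cAmin a b := by
  have := cHmin_pos ha hab hb; have := cCmax_pos ha; unfold cAmin; positivity

/-- `a_min ≤ α'`. [folklore] -/
theorem cAmin_le_bandNormalAngleDeriv {μ : ℝ} (hμ : μ ∈ Icc a b) (θ : ℝ) : cAmin a b ≤ bandNormalAngleDeriv μ θ := by
  obtain ⟨h1, h2⟩ := level_mem ha hb hμ
  have hc := bandNormalCoeff_pos h1 h2 θ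
  have hu := bandFermiRadius_pos h1 h2 θ
  have hcmaxpos := cCmax_pos ha
  have hhminpos := cHmin_pos ha hab hb
  rw [bandNormalAngleDeriv_eq_hess_div h1 h2 θ]
  unfold cAmin
  have hden_pos : 0 < bandNormalCoeff μ θ * (bandFermiRadius μ θ ^ 2 + bandFermiRadiusDeriv μ θ ^ 2) := by
    positivity
  have hd2 : bandFermiRadiusDeriv μ θ ^ 2 ≤ cU1 b ^ 2 := by
    rw [← sq_abs]; exact pow_le_pow_left₀ (abs_nonneg _) (abs_deriv_le_cU1 ha hab hb hμ θ) 2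
  have hu2 : bandFermiRadius μ θ ^ 2 ≤ 25 := by nlinarith [u_le_five ha hb hμ θ]
  have hden_le : bandNormalCoeff μ θ * (bandFermiRadius μ θ ^ 2 + bandFermiRadiusDeriv μ θ ^ 2) ≤
      cCmax a * (25 + cU1 b ^ 2) :=
    mul_le_mul (bandNormalCoeff_le_cCmax ha hb hμ θ) (by linarith) (by positivity) hcmaxpos.le
  calc cHmin a b / (cCmax a * (25 + cU1 b ^ 2))
      ≤ cHmin a b / (bandNormalCoeff μ θ * (bandFermiRadius μ θ ^ 2 + bandFermiRadiusDeriv μ θ ^ 2)) :=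
        div_le_div_of_nonneg_left hhminpos.le hden_pos hden_le
    _ ≤ _ := div_le_div_of_nonneg_right (cHmin_le_hess ha hab hb hμ θ) hden_pos.le

/-- **The Gauss map is uniformly expanding**: `a_min |θ - θ'| ≤ |α(θ) - α(θ')|`. [folklore] -/
theorem gauss_expand {μ : ℝ} (hμ : μ ∈ Icc a b) (θ θ' : ℝ) :
    cAmin a b * |θ - θ'| ≤ |bandNormalAngle μ θ - bandNormalAngle μ θ'| := by
  obtain ⟨h1, h2⟩ := level_mem ha hb hμ
  have hd : ∀ z, HasDerivAt (bandNormalAngle μ) (bandNormalAngleDeriv μ z) z := hasDerivAt_bandNormalAngle h1 h2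
  have hmono : ∀ x y : ℝ, x ≤ y → cAmin a b * (y - x) ≤ bandNormalAngle μ y - bandNormalAngle μ x := by
    intro x y hxy
    exact (convex_Icc x y).mul_sub_le_image_sub_of_le_deriv
      (fun z _ => (hd z).continuousAt.continuousWithinAt)
      (fun z _ => (hd z).differentiableAt.differentiableWithinAt)
      (fun z _ => by rw [(hd z).deriv]; exact cAmin_le_bandNormalAngleDeriv ha hab hb hμ z) x
      (left_mem_Icc.2 hxy) y (right_mem_Icc.2 hxy) hxy
  rcases le_total θ θ' with h | h
  · rw [abs_of_nonpos (sub_nonpos.2 h), abs_sub_comm]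
    calc cAmin a b * -(θ - θ') = cAmin a b * (θ' - θ) := by ring
      _ ≤ _ := (hmono θ θ' h).trans (le_abs_self _)
  · rw [abs_of_nonneg (sub_nonneg.2 h)]
    exact (hmono θ' θ h).trans (le_abs_self _)

/-- `0 < ρ_min`. [folklore] -/
theorem cRhomin_pos : 0 < cRhomin a b := mul_pos (cQ_pos ha hab hb) (cUmin_pos ha)

/-- `ρ_min ≤ ρ = √(sin² x + sin² y)`. [folklore] -/
theorem cRhomin_le_rho {μ : ℝ} (hμ : μ ∈ Icc a b) (θ : ℝ) :
    cRhomin a b ≤ Real.sqrt (Real.sin (bandX μ θ) ^ 2 + Real.sin (bandY μ θ) ^ 2) := by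
  obtain ⟨h1, h2⟩ := level_mem ha hb hμ
  have hc := bandNormalCoeff_pos h1 h2 θ
  have hqpos := cQ_pos ha hab hb
  have huminpos := cUmin_pos ha
  rw [rho_sq_eq h1 h2 θ]
  have hsq : cRhomin a b ^ 2 ≤ bandNormalCoeff μ θ ^ 2 * (bandFermiRadiusDeriv μ θ ^ 2 + bandFermiRadius μ θ ^ 2) := by
    have e1 : cQ b ^ 2 ≤ bandNormalCoeff μ θ ^ 2 := pow_le_pow_left₀ hqpos.le (cQ_le_bandNormalCoeff ha hab hb hμ θ) 2
    have e2 : cUmin a ^ 2 ≤ bandFermiRadiusDeriv μ θ ^ 2 + bandFermiRadius μ θ ^ 2 := by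
      have := pow_le_pow_left₀ huminpos.le (cUmin_le ha hb hμ θ) 2
      nlinarith [sq_nonneg (bandFermiRadiusDeriv μ θ)]
    calc cRhomin a b ^ 2 = cQ b ^ 2 * cUmin a ^ 2 := by unfold cRhomin; ring
      _ ≤ _ := mul_le_mul e1 e2 (by positivity) (by positivity)
  calc cRhomin a b = Real.sqrt (cRhomin a b ^ 2) := (Real.sqrt_sq (cRhomin_pos ha hab hb).le).symm
    _ ≤ _ := Real.sqrt_le_sqrt hsq

/-- `Dt_min ≤ ∂_t F`. [folklore] -/
theorem cDtmin_le {μ : ℝ} (hμ : μ ∈ Icc a b) (θ : ℝ) : cDtmin a b ≤ rayDispersionDt θ (bandFermiRadius μ θ) := by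
  have := Dt_ge_q ha hab hb hμ θ
  have hum := cUmin_le ha hb hμ θ
  have hq := cQ_pos ha hab hb
  calc cDtmin a b = 2 * cQ b * cUmin a := rfl
    _ ≤ 2 * cQ b * bandFermiRadius μ θ := mul_le_mul_of_nonneg_left hum (by positivity)
    _ ≤ _ := this

/-- **The bundle of uniform constants** on `[a, b] ⊂ (-4, 0)`. [folklore] -/
def bandBounds : BandBounds a b where
  ha := ha
  hb := hb
  umin := cUmin a
  smax := cSmax b
  A2 := cA2 a b
  hmin := cHmin a b
  amin := cAmin a b
  rhomin := cRhomin a b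
  cmax := cCmax a
  Dtmin := cDtmin a b
  umin_pos := cUmin_pos ha
  smax_pos := by have := cU1_pos ha hab hb; unfold cSmax; positivity
  A2_pos := cA2_pos ha hab hb
  hmin_pos := cHmin_pos ha hab hb
  amin_pos := cAmin_pos ha hab hb
  rhomin_pos := cRhomin_pos ha hab hb
  cmax_pos := cCmax_pos ha
  Dtmin_pos := by have := cQ_pos ha hab hb; have := cUmin_pos ha; unfold cDtmin; positivity
  umin_le := fun μ hμ θ => cUmin_le ha hb hμ θ
  abs_VX_le := fun μ hμ θ => abs_bandVX_le_cSmax ha hab hb hμ θ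
  abs_VY_le := fun μ hμ θ => abs_bandVY_le_cSmax ha hab hb hμ θ
  abs_AX_le := fun μ hμ θ => abs_bandAX_le_cA2 ha hab hb hμ θ
  abs_AY_le := fun μ hμ θ => abs_bandAY_le_cA2 ha hab hb hμ θ
  hess_ge := fun μ hμ θ => cHmin_le_hess ha hab hb hμ θ
  gauss := fun μ hμ θ θ' => gauss_expand ha hab hb hμ θ θ'
  rho_ge := fun μ hμ θ => cRhomin_le_rho ha hab hb hμ θ
  c_le := fun μ hμ θ => bandNormalCoeff_le_cCmax ha hb hμ θ
  Dt_ge := fun μ hμ θ => cDtmin_le ha hab hb hμ θ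

end Range

end Literature.MathematicalPhysics.QuantumLattice.BandSectorCounting

end
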